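/-
# Solo-blind programme on Kontsevich–Zagier, s6 part T3e: the duplication move

For an algebraic cut `u ∈ (0,1)` the dilogarithm cell `D(u) = [0 < t₁ < t₀ < u, dt/(t₀(1−t₁))]`
and the negative dilogarithm cell `D⁻(u) = [0 < t₁ < t₀ < u, dt/(t₀(1+t₁))]`
(`SoloBlindLandenChart`) live on the *same* triangle, and

  `1/(t₀(1−t₁)) = 1/(t₀(1+t₁)) + 2t₁/(t₀(1−t₁²))`,

so rule (1b) gives `[D(u)] = [D⁻(u)] + [E(u)]` with `E(u) = [0 < t₁ < t₀ < u, 2t₁dt/(t₀(1−t₁²))]`.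
The **squares chart** `(t₀,t₁) ↦ (t₀²,t₁²)` (a polynomial map, Jacobian `4t₀t₁`) carries the
triangle of `u` onto the triangle of `u²` and pulls `½·dilogFun` back to the form of `E(u)`
(rule (2)); halving an integrand is rule (1b) again.  Hence the **duplication formula as an
identity of KZ classes** (`two_nsmul_mkQ_dilogCut`):

  `2·[D(u)] = 2·[D⁻(u)] + [D(u²)]`  in `Q`,

with period shadow `2Li₂(u) + 2Li₂(−u) = Li₂(u²)` (`dilogCut_sq_value`).
-/
import Summits.KontsevichZagierPeriods.KontsevichZagierPeriods.Theorems.SoloBlindLandenChart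
import Summits.KontsevichZagierPeriods.KontsevichZagierPeriods.Theorems.SoloBlindEta

noncomputable section

open MeasureTheory Set MvPolynomial
open Literature.NumberTheory.Transcendental
open Literature.NumberTheory.Transcendental.KZ
open Literature.NumberTheory.Transcendental.KZ.IntegralRep
open Literature.ModelTheory.ExponentialFields (IsSemialgebraic isSemialgebraic_setOf_eval_pos)

namespace Summit.KontsevichZagierPeriods.KontsevichZagierPeriods.Theorems

namespace SoloBlind

/-! ## The squared cut -/

namespace Cut

variable (c : Cut)

/-- The squared cut `u²`. -/
def sq : Cut := ⟨c.x ^ 2, c.alg.pow 2, pow_pos c.pos 2, pow_lt_one₀ c.pos.le c.lt_one two_ne_zero⟩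

/-- Its cut point. -/
@[simp] theorem sq_x : c.sq.x = c.x ^ 2 := rfl

end Cut

variable (c : Cut)

/-! ## The integrand split `D(u) = D⁻(u) + E(u)` -/

/-- The form `2t₁/(t₀(1−t₁²))` of `E(u)`. -/
def dupFun (t : Fin 2 → ℝ) : ℝ := 2 * t 1 / (t 0 * (1 - t 1 ^ 2))

/-- On the triangle the three denominators are nonzero. -/
theorem dup_den_ne_zero {t : Fin 2 → ℝ} (ht : t ∈ cutDom c) :
    t 0 ≠ 0 ∧ 1 - t 1 ≠ 0 ∧ 1 + t 1 ≠ 0 := by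
  obtain ⟨h1, h2, h3⟩ := ht
  have := c.lt_one
  exact ⟨by linarith, by linarith, by linarith⟩

/-- The integrand identity `1/(t₀(1−t₁)) = 1/(t₀(1+t₁)) + 2t₁/(t₀(1−t₁²))`. -/
theorem dilogFun_eq_negFun_add_dupFun {t : Fin 2 → ℝ} (ht : t ∈ cutDom c) :
    dilogFun t = negFun t + dupFun t := by
  obtain ⟨h0, h1, h2⟩ := dup_den_ne_zero c ht
  have h3 : 1 - t 1 ^ 2 ≠ 0 := by
    rw [show 1 - t 1 ^ 2 = (1 - t 1) * (1 + t 1) by ring]; exact mul_ne_zero h1 h2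
  simp only [dilogFun, negFun, dupFun]
  field_simp
  ring

/-- **The cell `E(u) = [0 < t₁ < t₀ < u, 2t₁dt/(t₀(1−t₁²))]`**; it converges as the difference
of `D(u)` and `D⁻(u)`. -/
def dupRep : IntegralRep 2 :=
  ratRep (cutDom c) dupFun (2 * X 1) (X 0 * (1 - X 1 ^ 2)) (isSemialgebraic_cutDom c)
    (fun t ht => by
      obtain ⟨h0, h1, h2⟩ := dup_den_ne_zero c ht
      have h3 : 1 - t 1 ^ 2 ≠ 0 := by
        rw [show 1 - t 1 ^ 2 = (1 - t 1) * (1 + t 1) by ring]; exact mul_ne_zero h1 h2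
      simpa using mul_ne_zero h0 h3)
    (fun t _ => by simp [dupFun])
    ((((dilogCut c).integrableOn.sub (dilogNeg c.alg c.pos).integrableOn).congr_fun
        (fun t ht => by
          show dilogFun t - negFun t = dupFun t
          rw [dilogFun_eq_negFun_add_dupFun c ht, add_sub_cancel_left])
      (IsSemialgebraic.measurableSet_holds (isSemialgebraic_cutDom c))))

/-- **Integrand move (rule (1b)).** `[D(u)] − [D⁻(u)] − [E(u)]` is a relation. -/
theorem dilogCut_split : of (dilogCut c) - of (dilogNeg c.alg c.pos) - of (dupRep c) ∈
    relations :=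
  integrandAddRel_subset_relations ⟨2, dilogCut c, dilogNeg c.alg c.pos, dupRep c, rfl, rfl,
    fun _ ht => dilogFun_eq_negFun_add_dupFun c ht, rfl⟩

/-! ## The half cell and the squares chart -/

/-- **The half cell** `½D(u) = [0 < t₁ < t₀ < u, dt/(2t₀(1−t₁))]`. -/
def halfCut : IntegralRep 2 :=
  ratRep (cutDom c) (fun t => dilogFun t / 2) 1 (2 * (X 0 * (1 - X 1))) (isSemialgebraic_cutDom c)
    (fun t ht => by
      obtain ⟨h0, h1, _⟩ := dup_den_ne_zero c ht
      simpa using mul_ne_zero h0 h1)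
    (fun t _ => by simp [dilogFun, div_eq_mul_inv])
    ((dilogCut c).integrableOn.div_const 2)

/-- **Halving (rule (1b)).** `[D(u)] − [½D(u)] − [½D(u)]` is a relation. -/
theorem dilogCut_sub_two_halfCut : of (dilogCut c) - of (halfCut c) - of (halfCut c) ∈
    relations :=
  integrandAddRel_subset_relations ⟨2, dilogCut c, halfCut c, halfCut c, rfl, rfl,
    fun t _ => by show dilogFun t = dilogFun t / 2 + dilogFun t / 2; ring, rfl⟩

/-- The triangle lies in the open unit box. -/
theorem cutDom_subset_kzOpenBox : cutDom c ⊆ kzOpenBox 2 := by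
  intro t ⟨h1, h2, h3⟩ i
  have := c.lt_one
  fin_cases i
  · exact ⟨by show 0 < t 0; linarith, by show t 0 < 1; linarith⟩
  · exact ⟨by show 0 < t 1; linarith, by show t 1 < 1; linarith⟩

/-- The squares chart maps the triangle of `u` onto the triangle of `u²`. -/
theorem image_sqChart_cutDom : sqChart 2 '' cutDom c = cutDom c.sq := by
  ext y
  simp only [mem_image, cutDom, Cut.sq_x, mem_setOf_eq]
  constructor
  · rintro ⟨t, ⟨h1, h2, h3⟩, rfl⟩
    simp only [sqChart]
    exact ⟨pow_pos h1 2, pow_lt_pow_left₀ h2 h1.le two_ne_zero,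
      pow_lt_pow_left₀ h3 (h1.trans h2).le two_ne_zero⟩
  · rintro ⟨h1, h2, h3⟩
    have h0 : 0 < y 0 := h1.trans h2
    refine ⟨fun i => Real.sqrt (y i), ⟨Real.sqrt_pos.2 h1, Real.sqrt_lt_sqrt h1.le h2, ?_⟩,
      funext fun i => Real.sq_sqrt ?_⟩
    · rw [Real.sqrt_lt' c.pos]; exact h3
    · fin_cases i
      · exact h0.le
      · exact h1.le

/-- The squares chart is `ℚ`-semialgebraic on the triangle. -/
theorem isSemialgebraicMapOn_sqChart_cutDom : IsSemialgebraicMapOn ℚ (cutDom c) (sqChart 2) :=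
  IsSemialgebraicMapOn.of_forall (isSemialgebraic_cutDom c) fun i =>
    (isSemialgebraicFunOn_aeval (isSemialgebraic_cutDom c) (X i ^ 2)).congr fun x _ => by
      simp [sqChart]

/-- `E(u)`'s form is the pull-back of `½·dilogFun` along the squares chart. -/
theorem dupFun_eq_sqChart {t : Fin 2 → ℝ} (ht : t ∈ cutDom c) :
    dupFun t = dilogFun (sqChart 2 t) / 2 * (2 ^ 2 * ∏ i, t i) := by
  obtain ⟨h0, h1, h2⟩ := dup_den_ne_zero c ht
  have h3 : 1 - t 1 ^ 2 ≠ 0 := by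
    rw [show 1 - t 1 ^ 2 = (1 - t 1) * (1 + t 1) by ring]; exact mul_ne_zero h1 h2
  simp only [dupFun, dilogFun, sqChart, Fin.prod_univ_two]
  field_simp

/-- **Squares move (rule (2)).** `E(u) ≡ ½D(u²)`. -/
theorem dupRep_equiv_halfCut_sq : Equivalent (dupRep c) (halfCut c.sq) :=
  equivalent_of_chart (isSemialgebraicMapOn_sqChart_cutDom c) (fun t _ => hasFDerivAt_sqChart t)
    (injOn_sqChart.mono (cutDom_subset_kzOpenBox c)) (image_sqChart_cutDom c)
    (fun _ ht => abs_det_sqDeriv (cutDom_subset_kzOpenBox c ht))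
    (fun _ ht => dupFun_eq_sqChart c ht) rfl (fun _ _ => rfl) rfl (fun _ _ => rfl)

/-! ## The duplication formula -/

/-- **Duplication as an identity of KZ classes.** For every algebraic cut `u ∈ (0,1)`:
`2·[D(u)] = 2·[D⁻(u)] + [D(u²)]` in `Q = FormalRep/relations`. -/
theorem two_nsmul_mkQ_dilogCut : 2 • mkQ (of (dilogCut c)) =
    2 • mkQ (of (dilogNeg c.alg c.pos)) + mkQ (of (dilogCut c.sq)) := by
  have h1 : mkQ (of (dilogCut c)) = mkQ (of (dilogNeg c.alg c.pos)) + mkQ (of (dupRep c)) := by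
    rw [← map_add, mkQ_eq_mkQ_iff, ← sub_sub]; exact dilogCut_split c
  have h2 : mkQ (of (dupRep c)) = mkQ (of (halfCut c.sq)) :=
    mkQ_eq_mkQ_iff.2 (dupRep_equiv_halfCut_sq c)
  have h3 : mkQ (of (dilogCut c.sq)) = 2 • mkQ (of (halfCut c.sq)) := by
    rw [← map_nsmul, mkQ_eq_mkQ_iff, two_nsmul, ← sub_sub]; exact dilogCut_sub_two_halfCut c.sq
  rw [h1, h3, h2, smul_add]

/-- **Duplication for the periods**: `2Li₂(u) = 2(−Li₂(−u)) + Li₂(u²)`, i.e.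
`2·value D(u) = 2·value D⁻(u) + value D(u²)`. -/
theorem dilogCut_sq_value : (dilogCut c.sq).value =
    2 * (dilogCut c).value - 2 * (dilogNeg c.alg c.pos).value := by
  have h := congrArg evalQ (two_nsmul_mkQ_dilogCut c)
  rw [map_add, map_nsmul, map_nsmul, evalQ_mkQ, evalQ_mkQ, evalQ_mkQ, eval_of, eval_of, eval_of,
    nsmul_eq_mul, nsmul_eq_mul, Nat.cast_ofNat] at h
  linarith

end SoloBlind

end Summit.KontsevichZagierPeriods.KontsevichZagierPeriods.Theorems
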